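import Summits.BirchSwinnertonDyer.BirchSwinnertonDyer.Theorems.GoldfeldAllTwistsTwoConverseTwinAdditiveTwoPrimesTwistSelmerPOne
import HarnessLib

set_option linter.dupNamespace false -- namespace `…BirchSwinnertonDyer.BirchSwinnertonDyer…` is the cell's (D-0017 nested layout)
set_option autoImplicit false

/-!
# Cell C7A (and C7), file D0-(L2): the `2`-ADIC KILL of the classes `2, 14` on the `S`-side of the four descents
# (`49a1^{(u)}`, `49a1^{(2u)}` for `u ≡ 1 (mod 8)` — `u = p`, `u = −qp`), and of `2p, −14p ∈ S′(W)`, `2, −14 ∈ S′(49a1^{(2p)})` — FACT-FREE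

Cell `bsd-goldfeld`, seat `bsd-goldfeld-s1p-c3x` (gen 13); planner RULING (ccclx) «OBJECT C7A BY THE χ_Z CHANNEL», tranche T0, file D0-(L2) (memo
`HOME/C7A-CHIZ-CHANNEL.md` §3; director-bsd no-objection 20:49Z). `--supports stmt-BirchSwinnertonDyer-20044` as a HELPER. Theses-free; theorems only; no
definition, no fact binder, no `sorry`. FRONTIER-grade: a twist-density-ZERO sub-family modulo named print downstream; never distance-to-summit.

WHY. On the cells with `p ≡ 1 (mod 8)` (C7 = type β, C7A = type α; `q ≡ 7 (mod 8)`, `(p/q) = −1`) the twisting parameters `u ∈ {p, −qp}` are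
`≡ 1 (mod 8)`, i.e. SQUARES in `ℚ₂`: over `ℚ₂` the four curves `49a1^{(p)}`, `49a1^{(−qp)}` (models `⟨0, 21u, 0, 112u², 0⟩`) and `49a1^{(2p)}`,
`W = 49a1^{(−2qp)}` (models `⟨0, 42u, 0, 448u², 0⟩`) are `49a1` and `49a1^{(2)}` themselves, so every `2`-adic local condition of their `2`-isogeny descents
is ONE numeric quartic. The classes `2, 14 ∈ S` are such conditions: the kit column of `C7-HORIZON.md` §3 («`S = {1,2,7,14}`») was a false positive of the
script's Lemma-7 branch — exhaustively, `N² = 2M⁴ + aM²e² + (b/2)e⁴` has no primitive solution mod `2¹⁰` on the rows tested (memo §0), and here is the proof.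
* §1 Four numeric kills (`decide` in `ℤ/16` or `ℤ/4`, plus C3-1a's halving descent `padicInt_two_sq_ne_of_descend` for the deep charts):
  `(42; 2, 224)`, `(42; 14, 32)`, `(21; 2, 56)`, `(21; 14, 8)` have no non-trivial `ℚ₂`-point.
* §2 The rescaled class kills, `u ≡ 1 (mod 8)` (F9a's rescalings `isSoluble_two_of_sq_factor` BY NAME): classes `2, 14` of `S(42u, 448u²)` and of
  `S(21u, 112u²)`; and (via F9a's numeric `(−84; 2, −14)`) the classes `2p, −14p` of `S′(W) = S(84qp, −28q²p²)` and `2, −14` of `S′(49a1^{(2p)}) = S(−84p, −28p²)`.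
CONSEQUENCE (used by the D1 files): on C7/C7A `S(W) ⊆ {1, 7}` (with F9a's `S ⊆ {1,2,7,14}`), so the first descent of `W` is rank-one-SHARP and `Ш(W)[2] = 0`
needs no Cassels–Tate input there.
HONEST FRAMING: local lemmas only; no Selmer group is bounded in this file; items 19140 / 19350 / 20044 unchanged; BSD is not proved by any of this.

References: [SilvermanAEC2009] Prop. X.4.9, Example X.4.10; [Serre1973] Ch. II §3.3 Thm 4; [Zywina2025] Lemma 3.1.
-/

noncomputable section

open scoped Classical

open WeierstrassCurve Literature.NumberTheory.EllipticCurves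

namespace Summit.BirchSwinnertonDyer.BirchSwinnertonDyer.Theorems.GoldfeldGoodTwists

/-! ## §1 Four numeric `ℚ₂`-kills -/

section Numeric

/-- `ℤ/16` keys: `S² ≠ 2 + 42T² + 224T⁴` and `S² ≠ 14 + 42T² + 32T⁴` for all `T`. [folklore] -/
theorem keys_even_pOneAlpha :
    (∀ T S : ZMod (2 ^ 4), S ^ 2 ≠ ((2 : ℤ) : ZMod (2 ^ 4)) + ((42 : ℤ) : ZMod (2 ^ 4)) * T ^ 2 + ((224 : ℤ) : ZMod (2 ^ 4)) * T ^ 4) ∧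
    (∀ T S : ZMod (2 ^ 4), S ^ 2 ≠ ((14 : ℤ) : ZMod (2 ^ 4)) + ((42 : ℤ) : ZMod (2 ^ 4)) * T ^ 2 + ((32 : ℤ) : ZMod (2 ^ 4)) * T ^ 4) := by
  refine ⟨?_, ?_⟩ <;> decide

/-- `ℤ/16` odd-`T` keys for the deep charts: `224 + 42(2T+1)² + 2(2T+1)⁴`, `56 + 42(2T+1)² + 8(2T+1)⁴`, `32 + 42(2T+1)² + 14(2T+1)⁴`,
`8 + 42(2T+1)² + 56(2T+1)⁴` are never squares. [folklore] -/
theorem keys_even_odd_pOneAlpha :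
    (∀ T S : ZMod (2 ^ 4), S ^ 2 ≠ ((224 : ℤ) : ZMod (2 ^ 4)) + ((42 : ℤ) : ZMod (2 ^ 4)) * (2 * T + 1) ^ 2 +
      ((2 : ℤ) : ZMod (2 ^ 4)) * (2 * T + 1) ^ 4) ∧
    (∀ T S : ZMod (2 ^ 4), S ^ 2 ≠ ((56 : ℤ) : ZMod (2 ^ 4)) + ((42 : ℤ) : ZMod (2 ^ 4)) * (2 * T + 1) ^ 2 +
      ((4 * 2 : ℤ) : ZMod (2 ^ 4)) * (2 * T + 1) ^ 4) ∧
    (∀ T S : ZMod (2 ^ 4), S ^ 2 ≠ ((32 : ℤ) : ZMod (2 ^ 4)) + ((42 : ℤ) : ZMod (2 ^ 4)) * (2 * T + 1) ^ 2 +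
      ((14 : ℤ) : ZMod (2 ^ 4)) * (2 * T + 1) ^ 4) ∧
    (∀ T S : ZMod (2 ^ 4), S ^ 2 ≠ ((8 : ℤ) : ZMod (2 ^ 4)) + ((42 : ℤ) : ZMod (2 ^ 4)) * (2 * T + 1) ^ 2 +
      ((4 * 14 : ℤ) : ZMod (2 ^ 4)) * (2 * T + 1) ^ 4) := by
  refine ⟨?_, ?_, ?_, ?_⟩ <;> decide

/-- `ℤ/4` keys: `S² ≠ 2 + 21T² + 56T⁴`, `S² ≠ 14 + 21T² + 8T⁴` for all `T`; `56 + 21(2T+1)² + 2(2T+1)⁴`, `8 + 21(2T+1)² + 14(2T+1)⁴` never squares.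
[folklore] -/
theorem keys_odd_pOneAlpha :
    (∀ T S : ZMod (2 ^ 2), S ^ 2 ≠ ((2 : ℤ) : ZMod (2 ^ 2)) + ((21 : ℤ) : ZMod (2 ^ 2)) * T ^ 2 + ((56 : ℤ) : ZMod (2 ^ 2)) * T ^ 4) ∧
    (∀ T S : ZMod (2 ^ 2), S ^ 2 ≠ ((14 : ℤ) : ZMod (2 ^ 2)) + ((21 : ℤ) : ZMod (2 ^ 2)) * T ^ 2 + ((8 : ℤ) : ZMod (2 ^ 2)) * T ^ 4) ∧
    (∀ T S : ZMod (2 ^ 2), S ^ 2 ≠ ((14 : ℤ) : ZMod (2 ^ 2)) + ((21 : ℤ) : ZMod (2 ^ 2)) * T ^ 2 + ((4 * 2 : ℤ) : ZMod (2 ^ 2)) * T ^ 4) ∧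
    (∀ T S : ZMod (2 ^ 2), S ^ 2 ≠ ((2 : ℤ) : ZMod (2 ^ 2)) + ((21 : ℤ) : ZMod (2 ^ 2)) * T ^ 2 + ((4 * 14 : ℤ) : ZMod (2 ^ 2)) * T ^ 4) ∧
    (∀ T S : ZMod (2 ^ 2), S ^ 2 ≠ ((56 : ℤ) : ZMod (2 ^ 2)) + ((21 : ℤ) : ZMod (2 ^ 2)) * (2 * T + 1) ^ 2 +
      ((2 : ℤ) : ZMod (2 ^ 2)) * (2 * T + 1) ^ 4) ∧
    (∀ T S : ZMod (2 ^ 2), S ^ 2 ≠ ((8 : ℤ) : ZMod (2 ^ 2)) + ((21 : ℤ) : ZMod (2 ^ 2)) * (2 * T + 1) ^ 2 +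
      ((14 : ℤ) : ZMod (2 ^ 2)) * (2 * T + 1) ^ 4) := by
  refine ⟨?_, ?_, ?_, ?_, ?_, ?_⟩ <;> decide

/-- `(42; 14, 32)`, chart `s² = 14 + 42t² + 32t⁴`: no `ℤ₂`-solution. [folklore] -/
theorem chart_fourteen_even_pOneAlpha (t s : ℤ_[2]) :
    s ^ 2 ≠ ((14 : ℤ) : ℤ_[2]) + ((42 : ℤ) : ℤ_[2]) * t ^ 2 + ((32 : ℤ) : ℤ_[2]) * t ^ 4 :=
  padicInt_two_sq_ne_of_zmodPow 4 keys_even_pOneAlpha.2 t s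

/-- `(42; 2, 224)`, chart `s² = 2 + 42t² + 224t⁴`: no `ℤ₂`-solution. [folklore] -/
theorem chart_two_even_pOneAlpha (t s : ℤ_[2]) :
    s ^ 2 ≠ ((2 : ℤ) : ℤ_[2]) + ((42 : ℤ) : ℤ_[2]) * t ^ 2 + ((224 : ℤ) : ℤ_[2]) * t ^ 4 :=
  padicInt_two_sq_ne_of_zmodPow 4 keys_even_pOneAlpha.1 t s

/-- **`w² = 2u⁴ + 42u²z² + 224z⁴` has no non-trivial `ℚ₂`-point** (chart `u = 1` mod `16`; chart `z = 1`: `u` odd dies mod `16`, `u` even halves twice,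
`224 → 56 → 14`, and dies mod `16`). [cite: SilvermanAEC2009, Prop. X.4.9 and Example X.4.10] -/
theorem not_isSoluble_two_numeric_two_even_pOneAlpha : ¬ ((twoIsogenyQuartic 42 2 224).map (Int.castRingHom ℚ_[2])).IsSoluble := by
  obtain ⟨k224, k56, -, -⟩ := keys_even_odd_pOneAlpha
  refine not_isSoluble_two_of_padicInt_charts chart_two_even_pOneAlpha ?_
  refine padicInt_two_sq_ne_of_descend 56 4 (by norm_num) k224 ?_
  refine padicInt_two_sq_ne_of_descend 14 4 (by norm_num) k56 ?_
  intro t s; push_cast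
  have h := chart_fourteen_even_pOneAlpha t s
  push_cast at h
  convert h using 2

/-- **`w² = 14u⁴ + 42u²z² + 32z⁴` has no non-trivial `ℚ₂`-point** (chart `u = 1` mod `16`; chart `z = 1`: odd dies mod `16`, even halves twice, `32 → 8 → 2`,
landing on the previous chart). [cite: SilvermanAEC2009, Prop. X.4.9 and Example X.4.10] -/
theorem not_isSoluble_two_numeric_fourteen_even_pOneAlpha :
    ¬ ((twoIsogenyQuartic 42 14 32).map (Int.castRingHom ℚ_[2])).IsSoluble := by
  obtain ⟨-, -, k32, k8⟩ := keys_even_odd_pOneAlpha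
  refine not_isSoluble_two_of_padicInt_charts chart_fourteen_even_pOneAlpha ?_
  refine padicInt_two_sq_ne_of_descend 8 4 (by norm_num) k32 ?_
  refine padicInt_two_sq_ne_of_descend 2 4 (by norm_num) k8 ?_
  intro t s; push_cast
  have h := chart_two_even_pOneAlpha t s
  push_cast at h
  convert h using 2

/-- **`w² = 2u⁴ + 21u²z² + 56z⁴` has no non-trivial `ℚ₂`-point** (mod `4`; the `z = 1` chart halves once, `56 → 14`).
[cite: SilvermanAEC2009, Prop. X.4.9 and Example X.4.10] -/
theorem not_isSoluble_two_numeric_two_odd_pOneAlpha : ¬ ((twoIsogenyQuartic 21 2 56).map (Int.castRingHom ℚ_[2])).IsSoluble := by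
  obtain ⟨k2, -, k14', -, k56, -⟩ := keys_odd_pOneAlpha
  refine not_isSoluble_two_of_padicInt_charts (padicInt_two_sq_ne_of_zmodPow 2 k2) ?_
  exact padicInt_two_sq_ne_of_descend 14 2 (by norm_num) k56 (padicInt_two_sq_ne_of_zmodPow 2 k14')

/-- **`w² = 14u⁴ + 21u²z² + 8z⁴` has no non-trivial `ℚ₂`-point** (mod `4`; the `z = 1` chart halves once, `8 → 2`).
[cite: SilvermanAEC2009, Prop. X.4.9 and Example X.4.10] -/
theorem not_isSoluble_two_numeric_fourteen_odd_pOneAlpha :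
    ¬ ((twoIsogenyQuartic 21 14 8).map (Int.castRingHom ℚ_[2])).IsSoluble := by
  obtain ⟨-, k14, -, k2', -, k8⟩ := keys_odd_pOneAlpha
  refine not_isSoluble_two_of_padicInt_charts (padicInt_two_sq_ne_of_zmodPow 2 k14) ?_
  exact padicInt_two_sq_ne_of_descend 2 2 (by norm_num) k8 (padicInt_two_sq_ne_of_zmodPow 2 k2')

end Numeric

/-! ## §2 The class kills for `u ≡ 1 (mod 8)` -/

section Classes
variable {u : ℤ}

/-- **Class `2 ∈ S(42u, 448u²)` dies at `2`** (`u ≡ 1 (mod 8)`; `49a1^{(2u)}`: `u = p` on C7/C7A for `49a1^{(2p)}`, `u = −qp` for `W = 49a1^{(−2qp)}`).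
[cite: SilvermanAEC2009, Prop. X.4.9 and Example X.4.10] [cite: Serre1973, Ch. II §3.3 Thm 4] -/
theorem not_isSoluble_two_class_two_even (h8 : (8 : ℤ) ∣ u - 1) {a d d' : ℤ} (ha : a = 42 * u) (hd : d = 2) (hd' : d' = 224 * u ^ 2) :
    ¬ ((twoIsogenyQuartic a d d').map (Int.castRingHom ℚ_[2])).IsSoluble := fun h ↦ by
  subst hd
  have h1 := isSoluble_two_of_sq_factor (n := u) (n₀ := 1) (by simpa using h8) (a₁ := 42) (e₁ := 224) (by rw [ha]; ring)
    (by rw [hd']; ring) h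
  norm_num at h1
  exact not_isSoluble_two_numeric_two_even_pOneAlpha h1

/-- **Class `14 ∈ S(42u, 448u²)` dies at `2`** (`u ≡ 1 (mod 8)`). [cite: SilvermanAEC2009, Prop. X.4.9 and Example X.4.10]
[cite: Serre1973, Ch. II §3.3 Thm 4] -/
theorem not_isSoluble_two_class_fourteen_even (h8 : (8 : ℤ) ∣ u - 1) {a d d' : ℤ} (ha : a = 42 * u) (hd : d = 14)
    (hd' : d' = 32 * u ^ 2) : ¬ ((twoIsogenyQuartic a d d').map (Int.castRingHom ℚ_[2])).IsSoluble := fun h ↦ by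
  subst hd
  have h1 := isSoluble_two_of_sq_factor (n := u) (n₀ := 1) (by simpa using h8) (a₁ := 42) (e₁ := 32) (by rw [ha]; ring)
    (by rw [hd']; ring) h
  norm_num at h1
  exact not_isSoluble_two_numeric_fourteen_even_pOneAlpha h1

/-- **Class `2 ∈ S(21u, 112u²)` dies at `2`** (`u ≡ 1 (mod 8)`; `49a1^{(u)}`: `u = p` for `49a1^{(p)}`, `u = −qp` for `49a1^{(−qp)}`).
[cite: SilvermanAEC2009, Prop. X.4.9 and Example X.4.10] [cite: Serre1973, Ch. II §3.3 Thm 4] -/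
theorem not_isSoluble_two_class_two_odd (h8 : (8 : ℤ) ∣ u - 1) {a d d' : ℤ} (ha : a = 21 * u) (hd : d = 2) (hd' : d' = 56 * u ^ 2) :
    ¬ ((twoIsogenyQuartic a d d').map (Int.castRingHom ℚ_[2])).IsSoluble := fun h ↦ by
  subst hd
  have h1 := isSoluble_two_of_sq_factor (n := u) (n₀ := 1) (by simpa using h8) (a₁ := 21) (e₁ := 56) (by rw [ha]; ring)
    (by rw [hd']; ring) h
  norm_num at h1
  exact not_isSoluble_two_numeric_two_odd_pOneAlpha h1

/-- **Class `14 ∈ S(21u, 112u²)` dies at `2`** (`u ≡ 1 (mod 8)`). [cite: SilvermanAEC2009, Prop. X.4.9 and Example X.4.10]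
[cite: Serre1973, Ch. II §3.3 Thm 4] -/
theorem not_isSoluble_two_class_fourteen_odd (h8 : (8 : ℤ) ∣ u - 1) {a d d' : ℤ} (ha : a = 21 * u) (hd : d = 14)
    (hd' : d' = 8 * u ^ 2) : ¬ ((twoIsogenyQuartic a d d').map (Int.castRingHom ℚ_[2])).IsSoluble := fun h ↦ by
  subst hd
  have h1 := isSoluble_two_of_sq_factor (n := u) (n₀ := 1) (by simpa using h8) (a₁ := 21) (e₁ := 8) (by rw [ha]; ring)
    (by rw [hd']; ring) h
  norm_num at h1
  exact not_isSoluble_two_numeric_fourteen_odd_pOneAlpha h1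

end Classes

/-! ## §3 The `S′`-side classes `2p, −14p` of `W` and `2, −14` of `49a1^{(2p)}` at `p ≡ 1 (mod 8)` (F9a's numeric `(−84; 2, −14)`) -/

section Dual
variable {q p : ℕ}

/-- **Class `2p ∈ S′(W) = S(84qp, −28q²p²)` dies at `2`** (`q ≡ 7 (8)`, `p ≡ 1 (8)`): `p ↦ 1` (common factor), `q ↦ −1` (square factor) give F9a's
`w² = 2u⁴ − 84u²z² − 14z⁴`. [cite: SilvermanAEC2009, Prop. X.4.9 and Example X.4.10] [cite: Serre1973, Ch. II §3.3 Thm 4] -/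
theorem not_isSoluble_two_dual_twoP_pOne (hq8 : q % 8 = 7) (hp8 : p % 8 = 1) {a d d' : ℤ} (ha : a = 84 * ((q : ℤ) * p))
    (hd : d = 2 * (p : ℤ)) (hd' : d' = -14 * ((q : ℤ) ^ 2 * p)) : ¬ ((twoIsogenyQuartic a d d').map (Int.castRingHom ℚ_[2])).IsSoluble :=
  fun h ↦ by
  have h1 := isSoluble_two_of_common_factor (n := p) (n₀ := 1) (by omega) (a₀ := 84 * q) (d₀ := 2) (e₀ := -14 * (q : ℤ) ^ 2)
    (by rw [ha]; ring) (by rw [hd]; ring) (by rw [hd']; ring) h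
  have h2 := isSoluble_two_of_sq_factor (n := q) (n₀ := -1) (by omega) (a₁ := 84) (d := 1 * 2) (e₁ := -14) (by ring) (by ring) h1
  norm_num at h2
  exact not_isSoluble_two_normalised_pOne h2

/-- **Class `−14p ∈ S′(W)` dies at `2`** (`q ≡ 7 (8)`, `p ≡ 1 (8)`). [cite: SilvermanAEC2009, Prop. X.4.9 and Example X.4.10]
[cite: Serre1973, Ch. II §3.3 Thm 4] -/
theorem not_isSoluble_two_dual_negFourteenP_pOne (hq8 : q % 8 = 7) (hp8 : p % 8 = 1) {a d d' : ℤ} (ha : a = 84 * ((q : ℤ) * p))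
    (hd : d = -14 * (p : ℤ)) (hd' : d' = 2 * ((q : ℤ) ^ 2 * p)) : ¬ ((twoIsogenyQuartic a d d').map (Int.castRingHom ℚ_[2])).IsSoluble :=
  fun h ↦ by
  have h1 := isSoluble_two_of_common_factor (n := p) (n₀ := 1) (by omega) (a₀ := 84 * q) (d₀ := -14) (e₀ := 2 * (q : ℤ) ^ 2)
    (by rw [ha]; ring) (by rw [hd]; ring) (by rw [hd']; ring) h
  have h2 := isSoluble_two_of_sq_factor (n := q) (n₀ := -1) (by omega) (a₁ := 84) (d := 1 * -14) (e₁ := 2) (by ring) (by ring) h1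
  norm_num at h2
  rw [isSoluble_map_twoIsogenyQuartic_comm] at h2
  exact not_isSoluble_two_normalised_pOne h2

/-- **Class `2 ∈ S′(49a1^{(2p)}) = S(−84p, −28p²)` dies at `2`** (`p ≡ 1 (8)`): `p ↦ 1` (square factor) gives `(−84; 2, −14)`.
[cite: SilvermanAEC2009, Prop. X.4.9 and Example X.4.10] [cite: Serre1973, Ch. II §3.3 Thm 4] -/
theorem not_isSoluble_two_dualPos_two_pOne (hp8 : p % 8 = 1) {a d d' : ℤ} (ha : a = -84 * (p : ℤ)) (hd : d = 2)
    (hd' : d' = -14 * (p : ℤ) ^ 2) : ¬ ((twoIsogenyQuartic a d d').map (Int.castRingHom ℚ_[2])).IsSoluble := fun h ↦ by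
  subst hd
  have h1 := isSoluble_two_of_sq_factor (n := p) (n₀ := 1) (by omega) (a₁ := -84) (e₁ := -14) (by rw [ha]; ring) (by rw [hd']; ring) h
  norm_num at h1
  exact not_isSoluble_two_normalised_pOne h1

/-- **Class `−14 ∈ S′(49a1^{(2p)})` dies at `2`** (`p ≡ 1 (8)`). [cite: SilvermanAEC2009, Prop. X.4.9 and Example X.4.10]
[cite: Serre1973, Ch. II §3.3 Thm 4] -/
theorem not_isSoluble_two_dualPos_negFourteen_pOne (hp8 : p % 8 = 1) {a d d' : ℤ} (ha : a = -84 * (p : ℤ)) (hd : d = -14)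
    (hd' : d' = 2 * (p : ℤ) ^ 2) : ¬ ((twoIsogenyQuartic a d d').map (Int.castRingHom ℚ_[2])).IsSoluble := fun h ↦ by
  subst hd
  have h1 := isSoluble_two_of_sq_factor (n := p) (n₀ := 1) (by omega) (a₁ := -84) (e₁ := 2) (by rw [ha]; ring) (by rw [hd']; ring) h
  norm_num at h1
  rw [isSoluble_map_twoIsogenyQuartic_comm] at h1
  exact not_isSoluble_two_normalised_pOne h1

end Dual

end Summit.BirchSwinnertonDyer.BirchSwinnertonDyer.Theorems.GoldfeldGoodTwists
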